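import Summits.NavierStokesRegularity.NavierStokesRegularity.Theorems.FrozenSignCascadeBoundedEnvelopeContinuationMorreyTypeIBound
import Summits.NavierStokesRegularity.NavierStokesRegularity.Theorems.HardyPointSinkHardyAncientLimitClassical
import Summits.NavierStokesRegularity.NavierStokesRegularity.Theorems.HardyPointSinkHardyAncientLimitMild
import Summits.NavierStokesRegularity.NavierStokesRegularity.Theorems.PlaneEnergyCeilingScaledEnergyOfPlanar
import Literature.Analysis.FluidPDE.AncientMildWeak
import Literature.Analysis.FluidPDE.CKNLocalRegularityRRSStep3
import Literature.Analysis.FluidPDE.LocalTypeIReverseTools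
import Literature.Analysis.FluidPDE.SpaceTimeCalculusC1
import Literature.Analysis.FluidPDE.TaoEnstrophyLocalisationProofs
import HarnessLib

/-!
# Route PlaneEnergyCeiling · crux `PlanarEnergyLiouville` (stmt-NavierStokesRegularity-16856),
# line `mean_dissipation_sieve`: stub S1 `stub_meanLocalDissipation`

Helper file (`--supports stmt-NavierStokesRegularity-16856`; theorems only, sorry-free). It proves
the registered stub **S1 — vanishing mean local dissipation** of the skeleton
`Cruxes/PlanarEnergyLiouville/Lines/mean_dissipation_sieve.lean` VERBATIM:
for a bounded ancient mild solution `v` (`ν = 1`, duality form of Koch–Nadirashvili–Seregin–Šverák)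
with measurable slices, jointly smooth on `(−∞,0) × ℝ³`, whose planar kinetic energies are bounded
by `M` on every plane and every slice, there is `C₁` such that for every `δ > 0` there is `R₁ > 0`
with `∫_T^{t₁} ∫_{B_R(x₀)} ‖∇v‖² ≤ C₁ R + δ (t₁ − T)` for all `R ≥ R₁`, all centres and all windows
`T < t₁ < 0`.

## The proof (assembled from tree theorems)

1. *Morrey bound.* The planar ceiling gives the scale-invariant Morrey bound
   `∫_{B_r(y)} ‖v(t)‖² ≤ 2 M r` at every slice, centre and radius (route support
   `ScaledEnergyOfPlanar`, `PlanarEnergyAPriori.planeEnergyCeiling_scaledEnergyOfPlanar`).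
2. *Oseen form.* A bounded ancient mild solution in duality form which is jointly continuous is a
   bounded weak solution (`IsBoundedAncientMildSolution.isBoundedWeakNSSolutionOn`); with the Morrey
   bound the parasitic drift of KNSS's Lemma 3.1 vanishes and `v` itself solves the Oseen integral
   equation between all pairs of negative times
   (`HardyAncientLimit.oseenMild_of_boundedWeak_ancient`), hence is a classical solution on
   `(−∞, 0)` for one smooth pressure (`HardyAncientLimit.exists_isClassicalNSSolutionOn_Iio_of_oseen`,
   Fabes–Jones–Rivière).
3. *The Albritton–Barker bound.* For a bounded classical ancient solution with the Morrey bound at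
   all radii, the scaled quantities `A + C + D + E` are bounded by one constant `K < ∞` on EVERY
   past parabolic ball (`BoundedEnvelope.exists_abScaledSum_le_of_morrey`: Seregin's estimates
   between the scaled energies, the local energy inequality, the mean-free pressure estimate, and
   a bootstrap towards large scales against the linear a priori growth). In particular the scaled
   dissipation obeys `∫∫_{Q(z,R)} ‖∇v‖² ≤ K R` for every `R > 0` and every apex `z` with `z.1 ≤ 0`.
4. *Covering.* A window `[T, t₁] × B_R(x₀)` is covered (up to a null set) by
   `N = ⌈2(t₁−T)/R²⌉` half-overlapping parabolic balls `Q((t₁ − kR²/2, x₀), R)`, so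
   `∫_T^{t₁}∫_{B_R(x₀)} ‖∇v‖² ≤ N K R ≤ K R + 2K(t₁−T)/R ≤ K R + δ (t₁ − T)` once `R ≥ 2K/δ`:
   the stub with `C₁ = K`.

So the "mean local dissipation" of the line card does not merely tend to zero: the dissipation is
scale-invariantly bounded on parabolic balls, and the long-window average in a fixed ball decays
like `K/R`.

## References

* D. Albritton, T. Barker, J. Math. Fluid Mech. 21 (2019) = arXiv:1811.00502, §3, Lemma 2.6.
  [AlbrittonBarker2019]
* G. Seregin, J. Math. Sci. 143 (2007) = arXiv:math/0607537, Lemma 2.1. [Seregin2006]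
* G. Koch, N. Nadirashvili, G. Seregin, V. Šverák, Acta Math. 203 (2009) = arXiv:0709.3599,
  Lemma 3.1, §4. [KochNadirashviliSereginSverak2009]
-/

-- Sub = summit for this single-conjunct summit: the duplicate namespace component is deliberate.
set_option linter.dupNamespace false

noncomputable section

open MeasureTheory Set Filter Metric Function Real
open _root_.Topology
open scoped ENNReal NNReal
open Literature.Analysis Literature.Analysis.FluidPDE

namespace Summit.NavierStokesRegularity.NavierStokesRegularity.Theorems.PlaneEnergyCeilingPlanarEnergyLiouville

/-! ### Covering a long window by half-overlapping parabolic windows -/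

/-- **Covering lemma.** For `R > 0`, `T < t₁` and `N ≥ 2(t₁ − T)/R²`, the integral of a
non-negative function over `[T, t₁]` is at most the sum over `k < N` of its integrals over the
half-overlapping windows `(t₁ − kR²/2 − R², t₁ − kR²/2)` (the time intervals of the parabolic balls
`Q((t₁ − kR²/2, x₀), R)`): every `t ∈ (T, t₁)` lies in the window `k = ⌈2(t₁−t)/R²⌉ − 1`, and
`[T, t₁]` and `(T, t₁)` differ by a null set. [folklore] -/
theorem lintegral_Icc_le_sum_windows (F : ℝ → ℝ≥0∞) {R T t₁ : ℝ} (hR : 0 < R)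
    {N : ℕ} (hN : 2 * (t₁ - T) / R ^ 2 ≤ N) :
    ∫⁻ t in Icc T t₁, F t ≤
      ∑ k : Fin N, ∫⁻ t in Ioo (t₁ - k * R ^ 2 / 2 - R ^ 2) (t₁ - k * R ^ 2 / 2), F t := by
  have hR2 : 0 < R ^ 2 := by positivity
  rw [← setLIntegral_congr (Ioo_ae_eq_Icc (μ := (volume : Measure ℝ)) (a := T) (b := t₁))]
  have hcov : Ioo T t₁ ⊆ ⋃ k : Fin N, Ioo (t₁ - k * R ^ 2 / 2 - R ^ 2) (t₁ - k * R ^ 2 / 2) := by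
    intro t ht
    set s : ℝ := 2 * (t₁ - t) / R ^ 2 with hs
    have hsR : s * R ^ 2 = 2 * (t₁ - t) := by rw [hs]; field_simp
    have hs0 : 0 < s := by rw [hs]; exact div_pos (by linarith [ht.2]) hR2
    have hsN : s ≤ N := by
      refine le_trans ?_ hN
      rw [hs]
      gcongr
      linarith [ht.1]
    have hceil1 : 1 ≤ ⌈s⌉₊ := Nat.one_le_iff_ne_zero.2 (Nat.pos_iff_ne_zero.1 (Nat.ceil_pos.2 hs0))
    set k : ℕ := ⌈s⌉₊ - 1 with hk
    have hk1 : (k : ℝ) = ⌈s⌉₊ - 1 := by rw [hk, Nat.cast_sub hceil1, Nat.cast_one]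
    have hks : (k : ℝ) < s := by
      rw [hk1]; have := Nat.ceil_lt_add_one hs0.le; linarith
    have hsk : s ≤ k + 1 := by rw [hk1]; have := Nat.le_ceil s; linarith
    have hkN : k < N := by
      have h1 : ⌈s⌉₊ ≤ N := Nat.ceil_le.2 hsN
      omega
    refine mem_iUnion.2 ⟨⟨k, hkN⟩, ?_, ?_⟩
    · show t₁ - (k : ℕ) * R ^ 2 / 2 - R ^ 2 < t
      nlinarith [hsk, hR2]
    · show t < t₁ - (k : ℕ) * R ^ 2 / 2
      nlinarith [hks, hR2]
  calc ∫⁻ t in Ioo T t₁, F t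
      ≤ ∫⁻ t in ⋃ k : Fin N, Ioo (t₁ - k * R ^ 2 / 2 - R ^ 2) (t₁ - k * R ^ 2 / 2), F t :=
        lintegral_mono_set hcov
    _ ≤ ∑' k : Fin N, ∫⁻ t in Ioo (t₁ - k * R ^ 2 / 2 - R ^ 2) (t₁ - k * R ^ 2 / 2), F t :=
        lintegral_iUnion_le _ _
    _ = ∑ k : Fin N, ∫⁻ t in Ioo (t₁ - k * R ^ 2 / 2 - R ^ 2) (t₁ - k * R ^ 2 / 2), F t :=
        tsum_fintype _

/-- **Arithmetic of the covering.** With `N = ⌈2L/R²⌉`, `L > 0`, `0 ≤ κ` and `R ≥ 2κ/δ` (`δ > 0`,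
`R > 0`): `N κ R ≤ κ R + δ L`. [folklore] -/
theorem ceil_mul_le_of_le {κ δ R L : ℝ} (hκ : 0 ≤ κ) (hδ : 0 < δ) (hR : 0 < R) (hL : 0 < L)
    (hRδ : 2 * κ / δ ≤ R) :
    (⌈2 * L / R ^ 2⌉₊ : ℝ) * (κ * R) ≤ κ * R + δ * L := by
  have hR2 : 0 < R ^ 2 := by positivity
  have hceil : (⌈2 * L / R ^ 2⌉₊ : ℝ) < 2 * L / R ^ 2 + 1 := Nat.ceil_lt_add_one (by positivity)
  have h1 : (⌈2 * L / R ^ 2⌉₊ : ℝ) * (κ * R) ≤ (2 * L / R ^ 2 + 1) * (κ * R) :=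
    mul_le_mul_of_nonneg_right hceil.le (by positivity)
  have h2 : (2 * L / R ^ 2 + 1) * (κ * R) = 2 * κ / R * L + κ * R := by
    field_simp
  have h3 : 2 * κ / R ≤ δ := by
    rw [div_le_iff₀ hR]
    rw [div_le_iff₀ hδ] at hRδ
    linarith
  have h4 : 2 * κ / R * L ≤ δ * L := mul_le_mul_of_nonneg_right h3 hL.le
  linarith

/-! ### From the Albritton–Barker bound to one parabolic ball -/

/-- `‖L‖ₑ² ≤ |L|²_F` in `ℝ≥0∞`: the operator norm is dominated by the Frobenius norm
(`sq_opNorm_le_frobeniusNormSq`). [folklore] -/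
theorem enorm_sq_le_ofReal_frobeniusNormSq
    (L : EuclideanSpace ℝ (Fin 3) →L[ℝ] EuclideanSpace ℝ (Fin 3)) :
    ‖L‖ₑ ^ 2 ≤ ENNReal.ofReal (frobeniusNormSq L) := by
  rw [← ofReal_norm, ← ENNReal.ofReal_pow (norm_nonneg _)]
  exact ENNReal.ofReal_le_ofReal (sq_opNorm_le_frobeniusNormSq L)

/-- **One parabolic ball.** If `(A + C + D + E)(Q(z, r)) ≤ K` for the gradient `G`, then
`∫∫_{Q(z,r)} |G|²_F ≤ K r` (`E(Q(z,r)) = r⁻¹ ∫∫_{Q(z,r)} |G|²_F ≤ A + C + D + E`). [folklore] -/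
theorem lintegral_parabolicCylinder_frobenius_le_of_abScaledSum_le
    {v : ℝ → EuclideanSpace ℝ (Fin 3) → EuclideanSpace ℝ (Fin 3)} {P : ℝ → EuclideanSpace ℝ (Fin 3) → ℝ}
    {G : ℝ → EuclideanSpace ℝ (Fin 3) → EuclideanSpace ℝ (Fin 3) →L[ℝ] EuclideanSpace ℝ (Fin 3)}
    {r : ℝ} (hr : 0 < r) {z : ℝ × EuclideanSpace ℝ (Fin 3)} {K : ℝ≥0∞}
    (hK : abScaledSum r z v P G ≤ K) :
    ∫⁻ q in parabolicCylinder r z, ENNReal.ofReal (frobeniusNormSq (G q.1 q.2)) ≤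
      K * ENNReal.ofReal r := by
  have hE : cknE r z G ≤ K := cknE_le_abScaledSum.trans hK
  unfold cknE at hE
  have hr0 : ENNReal.ofReal r ≠ 0 := (ENNReal.ofReal_pos.2 hr).ne'
  have hrt : ENNReal.ofReal r ≠ ⊤ := ENNReal.ofReal_ne_top
  calc ∫⁻ q in parabolicCylinder r z, ENNReal.ofReal (frobeniusNormSq (G q.1 q.2))
      = ENNReal.ofReal r * ((ENNReal.ofReal r)⁻¹ *
          ∫⁻ q in parabolicCylinder r z, ENNReal.ofReal (frobeniusNormSq (G q.1 q.2))) := by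
        rw [← mul_assoc, ENNReal.mul_inv_cancel hr0 hrt, one_mul]
    _ ≤ ENNReal.ofReal r * K := by gcongr
    _ = K * ENNReal.ofReal r := mul_comm _ _

/-- **Joint measurability of the dissipation density of a jointly smooth field**: for `v` jointly
`C^∞` on `(−∞,0) × ℝ³`, `q ↦ ‖∇v(q)‖ₑ²` is a.e.-measurable on every measurable `S ⊆ (−∞,0) × ℝ³`
(the slice gradient is jointly continuous there, `continuousOn_fderiv_slice_of_contDiffOn`).
[folklore] -/
theorem aemeasurable_enorm_fderiv_sq {v : ℝ → EuclideanSpace ℝ (Fin 3) → EuclideanSpace ℝ (Fin 3)}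
    (hsm : ContDiffOn ℝ (⊤ : ℕ∞) (uncurry v) (Iio 0 ×ˢ univ))
    {S : Set (ℝ × EuclideanSpace ℝ (Fin 3))} (hS : MeasurableSet S) (hsub : S ⊆ Iio 0 ×ˢ univ) :
    AEMeasurable (fun q : ℝ × EuclideanSpace ℝ (Fin 3) => ‖fderiv ℝ (v q.1) q.2‖ₑ ^ 2)
      (volume.restrict S) := by
  have hc : ContinuousOn (fun q : ℝ × EuclideanSpace ℝ (Fin 3) => fderiv ℝ (v q.1) q.2)
      (Iio 0 ×ˢ univ) :=
    continuousOn_fderiv_slice_of_contDiffOn (hsm.of_le (by norm_cast))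
      (uniqueDiffOn_Iio 0)
  have hn : ContinuousOn (fun q : ℝ × EuclideanSpace ℝ (Fin 3) => ‖fderiv ℝ (v q.1) q.2‖) S :=
    (continuous_norm.comp_continuousOn hc).mono hsub
  have hm : AEMeasurable (fun q : ℝ × EuclideanSpace ℝ (Fin 3) => ‖fderiv ℝ (v q.1) q.2‖)
      (volume.restrict S) := hn.aemeasurable hS
  have := (hm.ennreal_ofReal).pow_const 2
  refine this.congr (Eventually.of_forall fun q => ?_)
  simp only [ofReal_norm]

/-- **The window integral inside one parabolic ball.** For `v` jointly smooth on `(−∞,0) × ℝ³`,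
an apex `z` with `z.1 ≤ 0`, a radius `r > 0` and a bound `(A + C + D + E)(Q(z,r)) ≤ K` for
`G = ∇v`: `∫_{(z.1 − r², z.1)} ∫_{B_r(z.2)} ‖∇v‖ₑ² ≤ K r` (Tonelli, `‖·‖² ≤ |·|²_F`). [folklore] -/
theorem lintegral_window_ball_le_of_abScaledSum_le
    {v : ℝ → EuclideanSpace ℝ (Fin 3) → EuclideanSpace ℝ (Fin 3)} {P : ℝ → EuclideanSpace ℝ (Fin 3) → ℝ}
    (hsm : ContDiffOn ℝ (⊤ : ℕ∞) (uncurry v) (Iio 0 ×ˢ univ))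
    {r : ℝ} (hr : 0 < r) {z : ℝ × EuclideanSpace ℝ (Fin 3)} (hz : z.1 ≤ 0) {K : ℝ≥0∞}
    (hK : abScaledSum r z v P (fun t x => fderiv ℝ (v t) x) ≤ K) :
    ∫⁻ t in Ioo (z.1 - r ^ 2) z.1, ∫⁻ x in ball z.2 r, ‖fderiv ℝ (v t) x‖ₑ ^ 2 ≤
      K * ENNReal.ofReal r := by
  have hsub : parabolicCylinder r z ⊆ Iio 0 ×ˢ univ := by
    intro q hq
    rw [mem_parabolicCylinder] at hq
    exact ⟨lt_of_lt_of_le hq.1.2 hz, mem_univ _⟩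
  have hmeas := aemeasurable_enorm_fderiv_sq hsm (isOpen_parabolicCylinder r z).measurableSet hsub
  have h1 : ∫⁻ t in Ioo (z.1 - r ^ 2) z.1, ∫⁻ x in ball z.2 r, ‖fderiv ℝ (v t) x‖ₑ ^ 2 ≤
      ∫⁻ q in parabolicCylinder r z, ‖fderiv ℝ (v q.1) q.2‖ₑ ^ 2 :=
    RRS2016.lintegral_lintegral_le_of_prod_subset (I := Ioo (z.1 - r ^ 2) z.1) (B := ball z.2 r)
      (S := parabolicCylinder r z) (g := fun q => ‖fderiv ℝ (v q.1) q.2‖ₑ ^ 2)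
      (fun q hq => hq) hmeas
  have h2 : ∫⁻ q in parabolicCylinder r z, ‖fderiv ℝ (v q.1) q.2‖ₑ ^ 2 ≤
      ∫⁻ q in parabolicCylinder r z, ENNReal.ofReal (frobeniusNormSq (fderiv ℝ (v q.1) q.2)) :=
    lintegral_mono fun q => enorm_sq_le_ofReal_frobeniusNormSq _
  have h3 : ∫⁻ q in parabolicCylinder r z, ENNReal.ofReal (frobeniusNormSq (fderiv ℝ (v q.1) q.2)) ≤
      K * ENNReal.ofReal r :=
    lintegral_parabolicCylinder_frobenius_le_of_abScaledSum_le
      (G := fun t x => fderiv ℝ (v t) x) hr hK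
  exact h1.trans (h2.trans h3)

/-! ### From the planar ceiling to the Albritton–Barker bound -/

/-- **Real-valued Morrey bound from the `ℝ≥0∞` one**: for a continuous slice `w` with
`∫⁻_{B_r(y)} ‖w‖ₑ² ≤ 2 r M`, also `∫_{B_r(y)} ‖w‖² ≤ 2 M r` (Bochner). [folklore] -/
theorem integral_ball_sq_le_of_lintegral_le {w : EuclideanSpace ℝ (Fin 3) → EuclideanSpace ℝ (Fin 3)}
    (hw : Continuous w) {M : ℝ} (hM : 0 ≤ M) {y : EuclideanSpace ℝ (Fin 3)} {r : ℝ} (hr : 0 < r)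
    (h : ∫⁻ x in ball y r, ‖w x‖ₑ ^ 2 ≤ ENNReal.ofReal (2 * r * M)) :
    ∫ x in ball y r, ‖w x‖ ^ 2 ≤ 2 * M * r := by
  have hnn : 0 ≤ᵐ[volume.restrict (ball y r)] fun x => ‖w x‖ ^ 2 :=
    Eventually.of_forall fun x => by positivity
  have hsm : AEStronglyMeasurable (fun x => ‖w x‖ ^ 2) (volume.restrict (ball y r)) :=
    (hw.norm.pow 2).aestronglyMeasurable
  rw [integral_eq_lintegral_of_nonneg_ae hnn hsm]
  have h' : ∫⁻ x in ball y r, ENNReal.ofReal (‖w x‖ ^ 2) ≤ ENNReal.ofReal (2 * r * M) := by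
    refine le_trans (le_of_eq (lintegral_congr fun x => ?_)) h
    rw [← ofReal_norm, ENNReal.ofReal_pow (norm_nonneg _)]
  calc (∫⁻ x in ball y r, ENNReal.ofReal (‖w x‖ ^ 2)).toReal ≤ (ENNReal.ofReal (2 * r * M)).toReal :=
        ENNReal.toReal_mono ENNReal.ofReal_ne_top h'
    _ = 2 * M * r := by rw [ENNReal.toReal_ofReal (by positivity)]; ring

/-- **The Albritton–Barker bound for the crux class.** A bounded ancient mild solution (`ν = 1`)
with measurable slices, jointly smooth on `(−∞,0) × ℝ³`, whose planar energies are bounded on every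
plane and every slice, is a classical solution for some smooth pressure `P`, and the scaled
quantities `(A + C + D + E)(Q(z,r))` with `G = ∇v` are bounded by one finite constant over all past
parabolic balls (steps 1–3 of the module docstring). [cite: AlbrittonBarker2019, §3 and Lemma 2.6] -/
theorem exists_abScaledSum_le_of_planar {v : ℝ → EuclideanSpace ℝ (Fin 3) → EuclideanSpace ℝ (Fin 3)}
    (hv : IsBoundedAncientMildSolution 1 v)
    (hmeas : ∀ t < 0, AEStronglyMeasurable (v t) volume)
    (hsm : ContDiffOn ℝ (⊤ : ℕ∞) (uncurry v) (Iio 0 ×ˢ univ))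
    (hpl : ∃ M : ℝ, ∀ t < 0, ∀ (R : EuclideanSpace ℝ (Fin 3) ≃ₗᵢ[ℝ] EuclideanSpace ℝ (Fin 3)) (c : ℝ),
      ∫⁻ y : EuclideanSpace ℝ (Fin 2), ‖v t (R (WithLp.toLp 2 ![y 0, y 1, c]))‖ₑ ^ 2 ≤ ENNReal.ofReal M) :
    ∃ (P : ℝ → EuclideanSpace ℝ (Fin 3) → ℝ) (K : ℝ≥0∞), K ≠ ⊤ ∧
      IsClassicalNSSolutionOn (Iio 0) 1 0 v P ∧
      ∀ r : ℝ, 0 < r → ∀ z : ℝ × EuclideanSpace ℝ (Fin 3), z.1 ≤ 0 →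
        abScaledSum r z v P (fun t x => fderiv ℝ (v t) x) ≤ K := by
  -- ## constants
  obtain ⟨M₀, hM₀⟩ := hpl
  set M : ℝ := max M₀ 0 with hMdef
  have hM : 0 ≤ M := le_max_right _ _
  have hcont : ContinuousOn (uncurry v) (Iio 0 ×ˢ univ) := hsm.continuousOn
  have hslice : ∀ t < 0, Continuous (v t) := fun t ht =>
    (contDiff_slice_of_contDiffOn hsm (show t ∈ Iio 0 from ht)).continuous
  have hplM : ∀ t < 0, ∀ (R : EuclideanSpace ℝ (Fin 3) ≃ₗᵢ[ℝ] EuclideanSpace ℝ (Fin 3)) (c : ℝ),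
      ∫⁻ y : EuclideanSpace ℝ (Fin 2), ‖v t (R (WithLp.toLp 2 ![y 0, y 1, c]))‖ₑ ^ 2 ≤ ENNReal.ofReal M :=
    fun t ht R c => (hM₀ t ht R c).trans (ENNReal.ofReal_le_ofReal (le_max_left _ _))
  obtain ⟨V₀, hV₀⟩ := hv.2
  set V : ℝ := max V₀ 0 with hVdef
  have hV : 0 ≤ V := le_max_right _ _
  have hbd : ∀ t < 0, ∀ x, ‖v t x‖ ≤ V := fun t ht x => (hV₀ t ht x).trans (le_max_left _ _)
  -- ## step 1: the Morrey bound
  have hMorE : ∀ t < 0, ∀ (y : EuclideanSpace ℝ (Fin 3)) (r : ℝ), 0 < r →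
      ∫⁻ x in ball y r, ‖v t x‖ₑ ^ 2 ≤ ENNReal.ofReal (2 * r * M) := fun t ht y r hr =>
    PlanarEnergyAPriori.planeEnergyCeiling_scaledEnergyOfPlanar (v t) (hslice t ht) M hM
      (hplM t ht) y r hr
  have hMor : ∀ t < 0, ∀ (y : EuclideanSpace ℝ (Fin 3)) (r : ℝ), 0 < r →
      ∫ x in ball y r, ‖v t x‖ ^ 2 ≤ 2 * M * r := fun t ht y r hr =>
    integral_ball_sq_le_of_lintegral_le (hslice t ht) hM hr (hMorE t ht y r hr)
  have hMorN : ∀ t < 0, ∀ m : ℕ, 1 ≤ m →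
      ∫⁻ y in ball (0 : EuclideanSpace ℝ (Fin 3)) m, ‖v t y‖ₑ ^ 2 ≤ ENNReal.ofReal (2 * M * m) := by
    intro t ht m hm
    have hm0 : (0 : ℝ) < m := by exact_mod_cast hm
    have := hMorE t ht 0 m hm0
    rwa [mul_right_comm] at this
  -- ## step 2: bounded weak, Oseen-mild, classical
  have hjm : AEStronglyMeasurable (uncurry v)
      ((volume : Measure (ℝ × EuclideanSpace ℝ (Fin 3))).restrict (Iio 0 ×ˢ univ)) :=
    hcont.aestronglyMeasurable (measurableSet_Iio.prod MeasurableSet.univ)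
  have hweak := hv.isBoundedWeakNSSolutionOn one_pos hjm hmeas
  have hoseen := (HardyAncientLimit.oseenMild_of_boundedWeak_ancient hweak hcont hbd
    (I := 2 * M) (by positivity) (m₀ := 1) hMorN).2
  obtain ⟨P, hcl⟩ :=
    HardyAncientLimit.exists_isClassicalNSSolutionOn_Iio_of_oseen hcont hV hbd hv.1 hoseen
  -- ## step 3: the Albritton–Barker bound
  obtain ⟨K, hKt, hK⟩ :=
    BoundedEnvelope.exists_abScaledSum_le_of_morrey (M := 2 * M) (by positivity) hV hcl hMor hbd
  exact ⟨P, K, hKt, hcl, hK⟩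

/-! ### The stub -/

/-- **S1 — vanishing mean local dissipation (quantitative Theorem A)**, the registered stub
`stub_meanLocalDissipation` of the line `mean_dissipation_sieve` of the crux `PlanarEnergyLiouville`
(stmt-NavierStokesRegularity-16856), VERBATIM. For a bounded ancient mild solution (`ν = 1`, KNSS
duality class), measurable slices, jointly smooth on `(−∞,0) × ℝ³`, with planar kinetic energies
bounded by `M` on every plane and every slice: there is `C₁` such that for every `δ > 0` there is
`R₁ > 0` with `∫_{T}^{t₁} ∫_{B_R(x₀)} ‖∇v(t,x)‖² dx dt ≤ C₁ R + δ (t₁ − T)` for all `R ≥ R₁`, all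
centres `x₀` and all windows `T < t₁ < 0`. Proof: the Albritton–Barker bound
`∫∫_{Q(z,R)} ‖∇v‖² ≤ K R` on every past parabolic ball (`exists_abScaledSum_le_of_planar`) and the
covering of `[T,t₁] × B_R(x₀)` by `⌈2(t₁−T)/R²⌉` half-overlapping parabolic balls of radius `R`;
`C₁ = K`, `R₁ = max 1 (2K/δ)`. [cite: AlbrittonBarker2019, §3 and Lemma 2.6] -/
theorem stub_meanLocalDissipation :
    ∀ (v : ℝ → EuclideanSpace ℝ (Fin 3) → EuclideanSpace ℝ (Fin 3)),
      Literature.Analysis.FluidPDE.IsBoundedAncientMildSolution 1 v →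
      (∀ t < 0, MeasureTheory.AEStronglyMeasurable (v t) MeasureTheory.volume) →
      ContDiffOn ℝ (⊤ : ℕ∞) (Function.uncurry v) (Set.Iio 0 ×ˢ Set.univ) →
      (∃ M : ℝ, ∀ t < 0, ∀ (R : EuclideanSpace ℝ (Fin 3) ≃ₗᵢ[ℝ] EuclideanSpace ℝ (Fin 3)) (c : ℝ),
        ∫⁻ y : EuclideanSpace ℝ (Fin 2), ‖v t (R (WithLp.toLp 2 ![y 0, y 1, c]))‖ₑ ^ 2 ≤ ENNReal.ofReal M) →
      ∃ C₁ : ℝ, ∀ δ : ℝ, 0 < δ → ∃ R₁ : ℝ, 0 < R₁ ∧ ∀ R : ℝ, R₁ ≤ R →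
        ∀ (x₀ : EuclideanSpace ℝ (Fin 3)) (T t₁ : ℝ), T < t₁ → t₁ < 0 →
          ∫⁻ t in Set.Icc T t₁, ∫⁻ x in Metric.ball x₀ R, ‖fderiv ℝ (v t) x‖ₑ ^ 2
            ≤ ENNReal.ofReal (C₁ * R + δ * (t₁ - T)) := by
  intro v hv hmeas hsm hpl
  obtain ⟨P, K, hKt, -, hK⟩ := exists_abScaledSum_le_of_planar hv hmeas hsm hpl
  set κ : ℝ := K.toReal with hκdef
  have hκ : 0 ≤ κ := ENNReal.toReal_nonneg
  have hKκ : K = ENNReal.ofReal κ := (ENNReal.ofReal_toReal hKt).symm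
  refine ⟨κ, fun δ hδ => ⟨max 1 (2 * κ / δ), lt_of_lt_of_le one_pos (le_max_left _ _), ?_⟩⟩
  intro R hR x₀ T t₁ hT ht₁
  have hR0 : 0 < R := lt_of_lt_of_le one_pos ((le_max_left _ _).trans hR)
  have hRδ : 2 * κ / δ ≤ R := (le_max_right _ _).trans hR
  set L : ℝ := t₁ - T with hL
  have hL0 : 0 < L := by rw [hL]; linarith
  set N : ℕ := ⌈2 * L / R ^ 2⌉₊ with hN
  have hNle : 2 * (t₁ - T) / R ^ 2 ≤ N := by rw [hN, ← hL]; exact Nat.le_ceil _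
  -- each window is the time interval of a past parabolic ball of radius `R`
  have hwin : ∀ k : Fin N,
      ∫⁻ t in Ioo (t₁ - k * R ^ 2 / 2 - R ^ 2) (t₁ - k * R ^ 2 / 2),
          ∫⁻ x in ball x₀ R, ‖fderiv ℝ (v t) x‖ₑ ^ 2 ≤ K * ENNReal.ofReal R := by
    intro k
    have hz : ((t₁ - k * R ^ 2 / 2, x₀) : ℝ × EuclideanSpace ℝ (Fin 3)).1 ≤ 0 := by
      show t₁ - k * R ^ 2 / 2 ≤ 0
      have : (0 : ℝ) ≤ k * R ^ 2 / 2 := by positivity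
      linarith
    exact lintegral_window_ball_le_of_abScaledSum_le hsm hR0 hz (hK R hR0 _ hz)
  calc ∫⁻ t in Icc T t₁, ∫⁻ x in ball x₀ R, ‖fderiv ℝ (v t) x‖ₑ ^ 2
      ≤ ∑ k : Fin N, ∫⁻ t in Ioo (t₁ - k * R ^ 2 / 2 - R ^ 2) (t₁ - k * R ^ 2 / 2),
          ∫⁻ x in ball x₀ R, ‖fderiv ℝ (v t) x‖ₑ ^ 2 :=
        lintegral_Icc_le_sum_windows _ hR0 hNle
    _ ≤ ∑ _k : Fin N, K * ENNReal.ofReal R := Finset.sum_le_sum fun k _ => hwin k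
    _ = (N : ℝ≥0∞) * (K * ENNReal.ofReal R) := by
        rw [Finset.sum_const, Finset.card_univ, Fintype.card_fin, nsmul_eq_mul]
    _ = ENNReal.ofReal ((N : ℝ) * (κ * R)) := by
        rw [hKκ, ← ENNReal.ofReal_mul hκ, ← ENNReal.ofReal_natCast, ← ENNReal.ofReal_mul (Nat.cast_nonneg _)]
    _ ≤ ENNReal.ofReal (κ * R + δ * (t₁ - T)) := by
        refine ENNReal.ofReal_le_ofReal ?_
        rw [hN, ← hL]
        exact ceil_mul_le_of_le hκ hδ hR0 hL0 hRδ

end Summit.NavierStokesRegularity.NavierStokesRegularity.Theorems.PlaneEnergyCeilingPlanarEnergyLiouville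

end
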